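import Literature.NumberTheory.GelbartRogawski1991.LocalUnitaryFrameTransport
import Literature.RepresentationTheory.SeesawScalarCharacter
import Literature.RepresentationTheory.TwistedCoinvariants
import Literature.NumberTheory.Automorphic.Liu2021.LemD1AsPrinted
import HarnessLib

-- buildfix G11b-3 recipe (as in the GelbartRogawski1991 siblings): sequential elaboration.
set_option Elab.async false

/-!
# Twist rigidity of the rank-one theta lift is invariant under a rational change of frame `T ↦ Pᵀ T P`

Topic `RepresentationTheory/MoeglinVignerasWaldspurger1987`; namespace
      `Literature.RepresentationTheory.MoeglinVignerasWaldspurger1987`.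
KERNEL only: theorems; no definition, no named fact, no `sorry`.

For `P ∈ GL_N(F)` with `Pᵀ T P = T'` (`J = T ⊗ 1`, `J' = T' ⊗ 1`) and a section `s` over `ι_T` at the finite place `v`,
the tree's `FrameTransport.frameSection s` is a section over `ι_{T'}` with `ω_{frameSection s}(g') = frameOp⁻¹
      ω_s(P g' P⁻¹) frameOp`
and `frameConj (z · 1) = z · 1` (`LocalUnitaryFrameTransport`).  Consequently:

* §1 `exists_coinvFrameEquiv χ : ∃ e : Θ_s(χ) ≃ Θ_{frameSection s}(χ)` — the `χ`-coinvariants under the centre correspond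
  along `frameOp⁻¹` (`TwistedCoinv.mapEquiv`), equivariantly for `g' ↦ P g' P⁻¹` (`mapEquiv_rep`);
* §2 `areIsomorphicRep_frame` — **`Θ_s(χ) ≅ η ⊗ Θ_s(χ′)` (as `U(J)(F_v)`-representations) implies
  `Θ_{s'}(χ) ≅ (η ∘ frameConj) ⊗ Θ_{s'}(χ′)` (as `U(J')(F_v)`-representations)**, `s' = frameSection s`;
* §3 **`twistRigid_of_frameTransport`** — if twist rigidity holds for `(T', s')` (every `η'` with open kernel and
  `Θ_{s'}(χ) ≅ η' ⊗ Θ_{s'}(χ′)` is trivial), then it holds for `(T, s)`.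

This moves the TwistRigid hypothesis of `rankOne_theta_twist_rigidity_of_twistRigid`
      (`RankOneThetaLiftTwistReduction.lean`)
from an arbitrary symmetric `T` to any rationally congruent frame, e.g. a block-diagonal one (route R for row IV-4c3).
HC_CM is NOT proved here and is proved only modulo the printed citations until rung 0 closes.

## References
* [MoeglinVignerasWaldspurger1987] LNM 1291 (1987), Chap. 2 II Remarques (2)–(3) (transport of structure), Chap. 3 IV.4.
* [GelbartRogawski1991] S. Gelbart, J. Rogawski, Invent. Math. 105 (1991), §3.1 Remark p. 457 (sections differing by a character).
-/

set_option autoImplicit false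

noncomputable section

open NumberField IsDedekindDomain
open scoped Matrix MatrixGroups
open Literature.RepresentationTheory.HeisenbergGroup (MpPsi)
open Literature.RepresentationTheory.TwistedCoinv
open Literature.NumberTheory.GelbartRogawski1991.UnitaryDualPair.LocalSplitting
open Literature.NumberTheory.GelbartRogawski1991.UnitaryDualPair.LocalSplitting.FrameTransport
open Literature.NumberTheory.Automorphic
open Literature.NumberTheory.Automorphic.Liu2021

namespace Literature.RepresentationTheory.MoeglinVignerasWaldspurger1987

/-! ## §0 Transport of «isomorphic up to a twist» along equivariant equivalences (generic) -/

/-- **generic transport**: if `e₁ : V₁ ≃ W₁`, `e₂ : V₂ ≃ W₂` intertwine `ρᵢ ∘ φ` with `σᵢ` (`σᵢ g' (eᵢ x) = eᵢ (ρᵢ (φ g') x)`)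
and `η' = η ∘ φ`, then `ρ₁ ≅ η ⊗ ρ₂` implies `σ₁ ≅ η' ⊗ σ₂` (the isomorphism `e₂ ∘ A ∘ e₁⁻¹`).
[cite: GelbartRogawski1991, §3.1 Remark p. 457] -/
private theorem areIsomorphicRep_twist_transport {G G' V₁ V₂ W₁ W₂ : Type*} [Group G] [Group G']
    [AddCommGroup V₁] [Module ℂ V₁] [AddCommGroup V₂] [Module ℂ V₂] [AddCommGroup W₁] [Module ℂ W₁]
    [AddCommGroup W₂] [Module ℂ W₂] {ρ₁ : Representation ℂ G V₁} {ρ₂ : Representation ℂ G V₂}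
    {σ₁ : Representation ℂ G' W₁} {σ₂ : Representation ℂ G' W₂} (φ : G' → G) (e₁ : V₁ ≃ₗ[ℂ] W₁) (e₂ : V₂ ≃ₗ[ℂ] W₂)
    (he₁ : ∀ (g' : G') (x : V₁), σ₁ g' (e₁ x) = e₁ (ρ₁ (φ g') x))
    (he₂ : ∀ (g' : G') (x : V₂), σ₂ g' (e₂ x) = e₂ (ρ₂ (φ g') x))
    (η : G →* ℂˣ) (η' : G' →* ℂˣ) (hη' : ∀ g', η' g' = η (φ g')) (h : AreIsomorphicRep ρ₁ (SeesawScalar.twist η ρ₂)) :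
    AreIsomorphicRep σ₁ (SeesawScalar.twist η' σ₂) := by
  obtain ⟨A, hA⟩ := h
  refine ⟨(e₁.symm ≪≫ₗ A) ≪≫ₗ e₂, fun g' y => ?_⟩
  obtain ⟨x, rfl⟩ := e₁.surjective y
  simp only [LinearEquiv.trans_apply]
  rw [he₁, LinearEquiv.symm_apply_apply, LinearEquiv.symm_apply_apply, hA, SeesawScalar.twist_apply,
    SeesawScalar.twist_apply, map_smul, ← he₂, hη']

variable (F : Type) [Field F] [NumberField F] (E : Type) [Field E] [NumberField E] [Algebra F E] (c : E ≃ₐ[F] E)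
  (v : HeightOneSpectrum (𝓞 F)) (N : ℕ) {T T' : Matrix (Fin N) (Fin N) F}
  {J : Matrix (Fin N) (Fin N) E} (hJ : J = T.map (algebraMap F E))
  {J' : Matrix (Fin N) (Fin N) E} (hJ' : J' = T'.map (algebraMap F E))
  (P : GL (Fin N) F) (hP : (P : Matrix (Fin N) (Fin N) F)ᵀ * T * (P : Matrix (Fin N) (Fin N) F) = T')
  (s : UnitaryGroup.localPi E c N J v →* LocalMp F N T v) {J₁ : Matrix (Fin 1) (Fin 1) E} (hJ₁ : J₁ 0 0 ≠ 0)

/-! ## §1 The coinvariant spaces along `frameOp⁻¹` -/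

/-- the transported Weil representation on the centre: `ω_{s'}(z·1) (frameOp⁻¹ f) = frameOp⁻¹ (ω_s(z·1) f)`.
[cite: MoeglinVignerasWaldspurger1987, Chap. 2 II Remarque (3)] -/
theorem toRep_frameSection_localCenter (z : UnitaryGroup.localPi E c 1 J₁ v) (f : SchwartzBruhat (Fin N →
      v.adicCompletion F)) :
    ((MonoidHom.comp (MpPsi.toRep (localSchrodinger F N T' v)) (frameSection F E c v N hJ hJ' P hP s)).comp
          (UnitaryGroup.localCenter E c N J' J₁ hJ₁ v)) z ((frameOp F v N P).symm f) =
      (((1 : UnitaryGroup.localPi E c 1 J₁ v → ℂˣ) z : ℂˣ) : ℂ) • (frameOp F v N P).symm (((MonoidHom.comp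
            (MpPsi.toRep (localSchrodinger F N T v)) s).comp (UnitaryGroup.localCenter E c N J J₁ hJ₁ v)) z f) := by
  simp only [MonoidHom.comp_apply, frameSection_apply, toRep_frameMp_symm_apply F v N P hP,
        LinearEquiv.apply_symm_apply,
    frameConj_localCenter, Pi.one_apply, Units.val_one, one_smul]

/-- the transported Weil representation: `ω_{s'}(g') (frameOp⁻¹ f) = frameOp⁻¹ (ω_s(P g' P⁻¹) f)`.
[cite: MoeglinVignerasWaldspurger1987, Chap. 2 II Remarque (3)] -/
theorem toRep_frameSection_symm (g' : UnitaryGroup.localPi E c N J' v) (f : SchwartzBruhat (Fin N →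
      v.adicCompletion F)) :
    (MonoidHom.comp (MpPsi.toRep (localSchrodinger F N T' v)) (frameSection F E c v N hJ hJ' P hP s)) g' ((frameOp
          F v N P).symm f) = (1 : ℂ) • (frameOp F v N P).symm ((MonoidHom.comp (MpPsi.toRep (localSchrodinger F N T
          v)) s) (frameConj F E c v N hJ hJ' P hP g') f) := by
  simp only [MonoidHom.comp_apply, frameSection_apply, toRep_frameMp_symm_apply F v N P hP,
        LinearEquiv.apply_symm_apply,
    one_smul]

-- the two `TwistedCoinv.rep` currencies and the twelve-argument `mapEquiv_rep`; about 2× the default budget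
set_option maxHeartbeats 400000 in
/-- **`Θ_s(χ) ≃ Θ_{frameSection s}(χ)` along `frameOp⁻¹`, equivariantly along `frameConj`**: there is a linear
equivalence `e` of the `χ`-coinvariants with `e (Θ_s(χ)(P g' P⁻¹) x) = Θ_{s'}(χ)(g') (e x)` (`TwistedCoinv.mapEquiv` /
`mapEquiv_rep` for the intertwiner `frameOp⁻¹`). [cite: MoeglinVignerasWaldspurger1987, Chap. 2 II Remarque (3)] -/
theorem exists_coinvFrameEquiv (χ : UnitaryGroup.localPi E c 1 J₁ v →* ℂˣ) :
    ∃ e : Coinv ((MonoidHom.comp (MpPsi.toRep (localSchrodinger F N T v)) s).comp (UnitaryGroup.localCenter E c N J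
          J₁ hJ₁ v)) χ ≃ₗ[ℂ] Coinv ((MonoidHom.comp (MpPsi.toRep (localSchrodinger F N T' v)) (frameSection F E c v
          N hJ hJ' P hP s)).comp (UnitaryGroup.localCenter E c N J' J₁ hJ₁ v)) χ,
      ∀ (g' : UnitaryGroup.localPi E c N J' v) (x : Coinv ((MonoidHom.comp (MpPsi.toRep (localSchrodinger F N T v))
            s).comp (UnitaryGroup.localCenter E c N J J₁ hJ₁ v)) χ),
        (TwistedCoinv.rep (ρW := (MonoidHom.comp (MpPsi.toRep (localSchrodinger F N T' v)) (frameSection F E c v N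
              hJ hJ' P hP s)).comp (UnitaryGroup.localCenter E c N J' J₁ hJ₁ v)) χ (MonoidHom.comp (MpPsi.toRep
              (localSchrodinger F N T' v)) (frameSection F E c v N hJ hJ' P hP s)) (fun g z => (show Commute g
              ((UnitaryGroup.localCenter E c N J' J₁ hJ₁ v) z) from UnitaryGroup.localCenter_comm E c N J' J₁ hJ₁ v
              z g).map (MonoidHom.comp (MpPsi.toRep (localSchrodinger F N T' v)) (frameSection F E c v N hJ hJ' P
              hP s)))) g' (e x) = e ((TwistedCoinv.rep (ρW := (MonoidHom.comp (MpPsi.toRep (localSchrodinger F N T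
              v)) s).comp (UnitaryGroup.localCenter E c N J J₁ hJ₁ v)) χ (MonoidHom.comp (MpPsi.toRep
              (localSchrodinger F N T v)) s) (fun g z => (show Commute g ((UnitaryGroup.localCenter E c N J J₁ hJ₁
              v) z) from UnitaryGroup.localCenter_comm E c N J J₁ hJ₁ v z g).map (MonoidHom.comp (MpPsi.toRep
              (localSchrodinger F N T v)) s))) (frameConj F E c v N hJ hJ' P hP g') x) := by
  refine ⟨mapEquiv ((MonoidHom.comp (MpPsi.toRep (localSchrodinger F N T v)) s).comp (UnitaryGroup.localCenter E c
        N J J₁ hJ₁ v)) χ ((MonoidHom.comp (MpPsi.toRep (localSchrodinger F N T' v)) (frameSection F E c v N hJ hJ'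
        P hP s)).comp (UnitaryGroup.localCenter E c N J' J₁ hJ₁ v)) χ (frameOp F v N P).symm 1
    (toRep_frameSection_localCenter F E c v N hJ hJ' P hP s hJ₁) (fun z => (one_mul _).symm), fun g' x => ?_⟩
  have h := mapEquiv_rep ((MonoidHom.comp (MpPsi.toRep (localSchrodinger F N T v)) s).comp
        (UnitaryGroup.localCenter E c N J J₁ hJ₁ v)) χ ((MonoidHom.comp (MpPsi.toRep (localSchrodinger F N T' v))
        (frameSection F E c v N hJ hJ' P hP s)).comp (UnitaryGroup.localCenter E c N J' J₁ hJ₁ v)) χ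
        (MonoidHom.comp (MpPsi.toRep (localSchrodinger F N T v)) s) (MonoidHom.comp (MpPsi.toRep (localSchrodinger
        F N T' v)) (frameSection F E c v N hJ hJ' P hP s))
    (fun g z => (show Commute g ((UnitaryGroup.localCenter E c N J J₁ hJ₁ v) z) from UnitaryGroup.localCenter_comm
          E c N J J₁ hJ₁ v z g).map (MonoidHom.comp (MpPsi.toRep (localSchrodinger F N T v)) s))
    (fun g z => (show Commute g ((UnitaryGroup.localCenter E c N J' J₁ hJ₁ v) z) from UnitaryGroup.localCenter_comm
          E c N J' J₁ hJ₁ v z g).map (MonoidHom.comp (MpPsi.toRep (localSchrodinger F N T' v)) (frameSection F E c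
          v N hJ hJ' P hP s)))
    (frameOp F v N P).symm 1 (toRep_frameSection_localCenter F E c v N hJ hJ' P hP s hJ₁) (fun z => (one_mul _).symm)
    (g := frameConj F E c v N hJ hJ' P hP g') (g' := g') (a := (1 : ℂ)) (toRep_frameSection_symm F E c v N hJ hJ' P
          hP s g') x
  exact h.trans (one_smul ℂ _)

/-! ## §2 Isomorphisms of twisted lifts move along the frame -/

-- four `TwistedCoinv.rep` currencies in one statement; about 2× the default budget
set_option maxHeartbeats 400000 in
/-- **`Θ_s(χ) ≅ η ⊗ Θ_s(χ′)` over `U(J)(F_v)` implies `Θ_{s'}(χ) ≅ (η ∘ frameConj) ⊗ Θ_{s'}(χ′)` over `U(J')(F_v)`.**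
[cite: MoeglinVignerasWaldspurger1987, Chap. 2 II Remarque (3)] -/
theorem areIsomorphicRep_frame (η : UnitaryGroup.localPi E c N J v →* ℂˣ) (χ χ' : UnitaryGroup.localPi E c 1 J₁ v →* ℂˣ)
    (h : AreIsomorphicRep (TwistedCoinv.rep (ρW := (MonoidHom.comp (MpPsi.toRep (localSchrodinger F N T v)) s).comp
          (UnitaryGroup.localCenter E c N J J₁ hJ₁ v)) χ (MonoidHom.comp (MpPsi.toRep (localSchrodinger F N T v))
          s) (fun g z => (show Commute g ((UnitaryGroup.localCenter E c N J J₁ hJ₁ v) z) from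
          UnitaryGroup.localCenter_comm E c N J J₁ hJ₁ v z g).map (MonoidHom.comp (MpPsi.toRep (localSchrodinger F
          N T v)) s))) (SeesawScalar.twist η (TwistedCoinv.rep (ρW := (MonoidHom.comp (MpPsi.toRep
          (localSchrodinger F N T v)) s).comp (UnitaryGroup.localCenter E c N J J₁ hJ₁ v)) χ' (MonoidHom.comp
          (MpPsi.toRep (localSchrodinger F N T v)) s) (fun g z => (show Commute g ((UnitaryGroup.localCenter E c N
          J J₁ hJ₁ v) z) from UnitaryGroup.localCenter_comm E c N J J₁ hJ₁ v z g).map (MonoidHom.comp (MpPsi.toRep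
          (localSchrodinger F N T v)) s))))) :
    AreIsomorphicRep (TwistedCoinv.rep (ρW := (MonoidHom.comp (MpPsi.toRep (localSchrodinger F N T' v))
          (frameSection F E c v N hJ hJ' P hP s)).comp (UnitaryGroup.localCenter E c N J' J₁ hJ₁ v)) χ
          (MonoidHom.comp (MpPsi.toRep (localSchrodinger F N T' v)) (frameSection F E c v N hJ hJ' P hP s)) (fun g
          z => (show Commute g ((UnitaryGroup.localCenter E c N J' J₁ hJ₁ v) z) from UnitaryGroup.localCenter_comm
          E c N J' J₁ hJ₁ v z g).map (MonoidHom.comp (MpPsi.toRep (localSchrodinger F N T' v)) (frameSection F E c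
          v N hJ hJ' P hP s)))) (SeesawScalar.twist (η.comp (frameConj F E c v N hJ hJ' P hP).toMonoidHom)
          (TwistedCoinv.rep (ρW := (MonoidHom.comp (MpPsi.toRep (localSchrodinger F N T' v)) (frameSection F E c v
          N hJ hJ' P hP s)).comp (UnitaryGroup.localCenter E c N J' J₁ hJ₁ v)) χ' (MonoidHom.comp (MpPsi.toRep
          (localSchrodinger F N T' v)) (frameSection F E c v N hJ hJ' P hP s)) (fun g z => (show Commute g
          ((UnitaryGroup.localCenter E c N J' J₁ hJ₁ v) z) from UnitaryGroup.localCenter_comm E c N J' J₁ hJ₁ v z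
          g).map (MonoidHom.comp (MpPsi.toRep (localSchrodinger F N T' v)) (frameSection F E c v N hJ hJ' P hP
          s))))) := by
  -- no `obtain` here: destructuring hypotheses of this size by `rcases` exhausts the heartbeat budget
  exact (exists_coinvFrameEquiv F E c v N hJ hJ' P hP s hJ₁ χ).elim fun e he =>
    (exists_coinvFrameEquiv F E c v N hJ hJ' P hP s hJ₁ χ').elim fun e' he' =>
      areIsomorphicRep_twist_transport (fun g' => frameConj F E c v N hJ hJ' P hP g') e e' he he' η _ (fun _ => rfl) h

/-! ## §3 Twist rigidity descends along the frame -/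

-- four `TwistedCoinv.rep` currencies in one statement; about 2× the default budget
set_option maxHeartbeats 400000 in
/-- **twist rigidity for `(T', frameSection s)` implies twist rigidity for `(T, s)`**: if every character `η'` of
`U(J')(F_v)` with open kernel such that `Θ_{s'}(χ) ≅ η' ⊗ Θ_{s'}(χ′)` is trivial, then every character `η` of `U(J)(F_v)`
with open kernel such that `Θ_s(χ) ≅ η ⊗ Θ_s(χ′)` is trivial (`η ∘ frameConj` has open kernel; `frameConj` is onto).
[cite: MoeglinVignerasWaldspurger1987, Chap. 3 IV.4; GelbartRogawski1991, §3.1 Remark p. 457] -/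
theorem twistRigid_of_frameTransport (χ χ' : UnitaryGroup.localPi E c 1 J₁ v →* ℂˣ)
    (h' : ∀ η' : UnitaryGroup.localPi E c N J' v →* ℂˣ,
      IsOpen ((η'.ker : Subgroup (UnitaryGroup.localPi E c N J' v)) : Set (UnitaryGroup.localPi E c N J' v)) →
        AreIsomorphicRep (TwistedCoinv.rep (ρW := (MonoidHom.comp (MpPsi.toRep (localSchrodinger F N T' v))
              (frameSection F E c v N hJ hJ' P hP s)).comp (UnitaryGroup.localCenter E c N J' J₁ hJ₁ v)) χ
              (MonoidHom.comp (MpPsi.toRep (localSchrodinger F N T' v)) (frameSection F E c v N hJ hJ' P hP s))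
              (fun g z => (show Commute g ((UnitaryGroup.localCenter E c N J' J₁ hJ₁ v) z) from
              UnitaryGroup.localCenter_comm E c N J' J₁ hJ₁ v z g).map (MonoidHom.comp (MpPsi.toRep
              (localSchrodinger F N T' v)) (frameSection F E c v N hJ hJ' P hP s)))) (SeesawScalar.twist η'
              (TwistedCoinv.rep (ρW := (MonoidHom.comp (MpPsi.toRep (localSchrodinger F N T' v)) (frameSection F E
              c v N hJ hJ' P hP s)).comp (UnitaryGroup.localCenter E c N J' J₁ hJ₁ v)) χ' (MonoidHom.comp
              (MpPsi.toRep (localSchrodinger F N T' v)) (frameSection F E c v N hJ hJ' P hP s)) (fun g z => (show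
              Commute g ((UnitaryGroup.localCenter E c N J' J₁ hJ₁ v) z) from UnitaryGroup.localCenter_comm E c N
              J' J₁ hJ₁ v z g).map (MonoidHom.comp (MpPsi.toRep (localSchrodinger F N T' v)) (frameSection F E c v
              N hJ hJ' P hP s))))) → η' = 1)
    (η : UnitaryGroup.localPi E c N J v →* ℂˣ)
    (hη : IsOpen ((η.ker : Subgroup (UnitaryGroup.localPi E c N J v)) : Set (UnitaryGroup.localPi E c N J v)))
    (hiso : AreIsomorphicRep (TwistedCoinv.rep (ρW := (MonoidHom.comp (MpPsi.toRep (localSchrodinger F N T v))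
          s).comp (UnitaryGroup.localCenter E c N J J₁ hJ₁ v)) χ (MonoidHom.comp (MpPsi.toRep (localSchrodinger F N
          T v)) s) (fun g z => (show Commute g ((UnitaryGroup.localCenter E c N J J₁ hJ₁ v) z) from
          UnitaryGroup.localCenter_comm E c N J J₁ hJ₁ v z g).map (MonoidHom.comp (MpPsi.toRep (localSchrodinger F
          N T v)) s))) (SeesawScalar.twist η (TwistedCoinv.rep (ρW := (MonoidHom.comp (MpPsi.toRep
          (localSchrodinger F N T v)) s).comp (UnitaryGroup.localCenter E c N J J₁ hJ₁ v)) χ' (MonoidHom.comp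
          (MpPsi.toRep (localSchrodinger F N T v)) s) (fun g z => (show Commute g ((UnitaryGroup.localCenter E c N
          J J₁ hJ₁ v) z) from UnitaryGroup.localCenter_comm E c N J J₁ hJ₁ v z g).map (MonoidHom.comp (MpPsi.toRep
          (localSchrodinger F N T v)) s))))) : η = 1 := by
  have hopen : IsOpen (((η.comp (frameConj F E c v N hJ hJ' P hP).toMonoidHom).ker :
      Subgroup (UnitaryGroup.localPi E c N J' v)) : Set (UnitaryGroup.localPi E c N J' v)) := by
    rw [← MonoidHom.comap_ker]
    exact hη.preimage (frameConj F E c v N hJ hJ' P hP).continuous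
  have h1 := h' _ hopen (areIsomorphicRep_frame F E c v N hJ hJ' P hP s hJ₁ η χ χ' hiso)
  refine MonoidHom.ext fun g => ?_
  have h2 := DFunLike.congr_fun h1 ((frameConj F E c v N hJ hJ' P hP).symm g)
  rw [MonoidHom.comp_apply, MonoidHom.one_apply] at h2
  have h3 : (frameConj F E c v N hJ hJ' P hP).toMonoidHom ((frameConj F E c v N hJ hJ' P hP).symm g) = g :=
    (frameConj F E c v N hJ hJ' P hP).apply_symm_apply g
  rw [h3] at h2
  rw [h2, MonoidHom.one_apply]

end Literature.RepresentationTheory.MoeglinVignerasWaldspurger1987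

end
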